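import Literature.Barriers.ValiantsHypothesis.AlgebraicNaturalProofsKRST

/-!
# Crux `BarrierLever.SuccinctHittingSetsForVP` (stmt-ValiantsHypothesis-14610) — the `VP` statement of
# the Kumar–Ramya–Saptharishi–Tengse argument with its ONE non-kernel input displayed

The Literature file `AlgebraicNaturalProofsKRST.lean` proves, unconditionally, the class-generic
conclusion `isSuccinctHittingSet_of_permanentExpHard : PermanentExpHardWith F c m₀ → (eventual
𝒞-succinctness of KRST's generator) → hitting`. Here the class is `SmallCircuits F n b` (`VP`): the
succinctness clause becomes the HYPOTHESIS `KRSTSuccinctInVP F c b` — an unproven statement about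
the crux, NOT a result in print (KRST 2022 §4 asks it as their open problem 1; Bürgisser 2024 §7.3),
hence Summit-side — and the conclusion is FSV Question 6, the crux:
`succinctHittingSetsForVP_of_permanentExpHard : PermanentExpHardWith F c m₀ → KRSTSuccinctInVP F c b → SuccinctHittingSetsForVP F`.

Status of the hypothesis (ruling of record D-0053, cell `valiant-natproofs`): the full algebraic
natural-proofs barrier for `VP` is CONDITIONAL on a succinct-generator / algebraic-PRF-type
hypothesis and is NOT derivable from permanent hardness by the known generator technology —
kernel no-go theorems: the joint form is refuted under permanent hardness
(`AlgebraicNaturalProofsPlanting.not_jointlySuccinct_of_plantsPermanentAt`), and the per-seed form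
`KRSTSuccinctInVP ℂ c b` is refuted for every `6c ≥ 5b + 24` by a dimension count
(`…KRSTEdge.krst_not_idealSuccinct_eventually`, `…KRSTEdgeVP.not_KRSTSuccinctInVP`); it is
undecided only in the band `b > (6c − 24)/5`. Nothing here supports it. Does NOT close the item.

WHAT THIS IS NOT: not a proof of FSV Question 6, not a lower bound.

References: [KumarRamyaSaptharishiTengse2022] Thm. MainThm, §3.5, §4 (open problem 1);
[Burgisser2024Completeness] §7.3.
-/

-- layout Summits/ValiantsHypothesis/ValiantsHypothesis forces the duplicated namespace component
set_option linter.dupNamespace false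

noncomputable section

namespace Summit.ValiantsHypothesis.ValiantsHypothesis.Theorems.BarrierLever.SuccinctHittingSetsForVP

namespace KRSTDoor

open Literature.Barriers.ValiantsHypothesis Literature.Computability.AlgebraicComplexity MvPolynomial

variable (F : Type*) [Field F]

/-- **The `VP` succinctness hypothesis for KRST's generator** (the statement KRST 2022 §4 asks for
as their open problem 1; an unproven HYPOTHESIS about the crux, asserted nowhere, refuted over `ℂ`
for `6c ≥ 5b + 24` by `…KRSTEdgeVP.not_KRSTSuccinctInVP`): for all large `n`, KRST's generator on
`per` is `SmallCircuits F n b`-succinct, i.e. every `Σ_{|μ| ≤ n} Perm_[p](y|_{S_μ}) x^μ` has degree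
`≤ n` and circuit size `≤ n^b`. [cite: KumarRamyaSaptharishiTengse2022, §4] -/
def KRSTSuccinctInVP (c b : ℕ) : Prop :=
  ∃ n₀ : ℕ, ∀ n : ℕ, n₀ ≤ n → KRSTSuccinctIn F (fun n => SmallCircuits F n b) c n

variable {F} [CharZero F]

/-- **The `VP` statement with its one non-kernel input displayed:** exponential hardness of the
permanent AND the succinctness hypothesis `KRSTSuccinctInVP F c b` give `SuccinctHittingSetsForVP F`
(FSV Question 6), with ONE succinctness exponent `b` serving every distinguisher level `a`. By the
ruling of record (D-0053; file header) this is a barrier CONDITIONAL on a succinct-generator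
hypothesis, not a derivation from hardness; over `ℂ` the second hypothesis is satisfiable only if
`6c < 5b + 24` (`…KRSTEdgeVP.lt_of_KRSTSuccinctInVP`). [cite: KumarRamyaSaptharishiTengse2022, Thm. MainThm and §4] -/
theorem succinctHittingSetsForVP_of_permanentExpHard {c m₀ b : ℕ}
    (hper : PermanentExpHardWith F c m₀) (hsucc : KRSTSuccinctInVP F c b) :
    SuccinctHittingSetsForVP F := by
  intro a
  obtain ⟨n₀, hn₀⟩ := isSuccinctHittingSet_of_permanentExpHard hper hsucc a
  exact ⟨b, n₀, hn₀⟩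

/-- Under the same two hypotheses (the second unproven, see above), no algebraically natural proof
of any constructivity level shows that any family lies outside `VP`.
[cite: KumarRamyaSaptharishiTengse2022, §4] -/
theorem not_naturalProofAgainstVP_of_permanentExpHard {c m₀ b : ℕ}
    (hper : PermanentExpHardWith F c m₀) (hsucc : KRSTSuccinctInVP F c b) (a : ℕ)
    (t : ∀ n, MvPolynomial (Fin n) F) : ¬ NaturalProofAgainstVP F a t :=
  algebraicNaturalProofs_holds F (succinctHittingSetsForVP_of_permanentExpHard hper hsucc) a t

end KRSTDoor

end Summit.ValiantsHypothesis.ValiantsHypothesis.Theorems.BarrierLever.SuccinctHittingSetsForVP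

end
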